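import Literature.AnabelianGeometry.EtaleTheta.FrobenioidThetaBiKummer
import Literature.AnabelianGeometry.EtaleTheta.SectionTorsionSubgroup
import Mathlib.Algebra.Group.Subgroup.Pointwise
import Mathlib.Tactic.Group

/-!
# [EtTh] §5: Frobenioid-theoretic theta environments — Lemma 5.8, Lemma 5.9 (i)–(iii), Theorem 5.10 (i)–(ii) (pp. 330–335 / PDF pp. 104–109)

Mochizuki, *The étale theta function …*, Publ. RIMS **45** (2009) [cite: MochizukiEtTh2009, §5 p.330 (PDF p.104)].
Seat abc-iut-L2-t4.  Over the §5 data `ThetaFrobenioid` (`FrobenioidTheta.lean`,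
`FrobenioidThetaBiKummer.lean`) and the abstract group theory of `SectionTorsionSubgroup.lean`:
* p.330 (PDF p.104): "`B_N` is Aut-ample" as a named hypothesis (`O^×(B_N) = Ker` is PROVED in `FrobenioidTheta.lean`);
* `E^Π_N = E_N ×_{Im(Π^tp_Y̲)} Π^tp_Y̲` with its projections `ϵ`, `E^Π_N ↠ Π^tp_Y̲` (Lemma 5.9 (iv), Thm. 5.10);
* **Lemma 5.8** (Conjugation by Constants): `(O_K^×)^{1/N}` "is equal to the set of elements of
  `O^×(B_N)` that normalize the subgroup `E_N ⊆ Aut_C(B_N)`" (`ConstantsEqNormalizer`), typed together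
  with the two steps of its proof — the group-theoretic step is PROVED here from
  `SectionTorsionSubgroup.kernel_mem_normalizer_iff` (`mem_normalizer_EN_iff`), the arithmetic step
  ("this last set is easily seen to coincide with `(O_K^×)^{1/N}`", Kummer theory over `K`) is the
  named fact `ConstantsActByCyclotome`; hence `constantsEqNormalizer_of`;
* **Lemma 5.9 (i)** (`SectionsFactor`) PROVED from the bi-Kummer cocycle fact (Prop. 4.3 (iii));
  **(ii)** (`ENExact`: `1 → μ_N(B_N) → E_N → Im(Π^tp_Y̲) → 1`) PROVED from the section property of
  `s^⊓-gp_N`; **(iii)** (`OuterActionLZ`: `Π^tp_X̲` normalises `E_N` through `s^⊓-gp_N ∘ ρ`, with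
  `Π^tp_Y̲` acting innerly, whence `l·ℤ ≅ Π^tp_X̲/Π^tp_Y̲ → Out(E_N)`) PROVED;
* **Theorem 5.10 (i)** (`PreservesIsoClasses`) and **(ii)** (`PsiAutPreserves`), with
  `Ψ^Aut := Inn(β) ∘ Ψ` DEFINED (`psiAut`).
Lemma 5.9 (iv)–(v), Theorem 5.10 (iii) and Remarks 5.10.1–5.10.4 (the comparison with the mono-theta
environments of §2) are typed against abc-iut-L2-t2's `MonoThetaEnv` interface in
`FrobenioidMonoThetaEnv.lean`.  HONEST FRAMING: named facts are `Prop`s, never asserted; the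
theorems below are discharges of printed claims MODULO the named hypotheses they list.
-/

namespace Literature.AnabelianGeometry.EtaleTheta

open CategoryTheory
open scoped Pointwise

universe w v v' u u'

namespace ThetaFrobenioid

variable {C : Type u} [Category.{v} C] {D : Type u'} [Category.{v'} D] (𝔉 : ThetaFrobenioid.{w} C D)

/-! ### p. 330: `B_N` is Aut-ample; `O^×(B_N)` is the kernel of `Aut_C(B_N) → Aut_D(B_N^bs)` -/

/-- "Note that the zero divisor `Div(s^⊓_N) ∈ Φ(A_N)` of `s^⊓_N` descends … to `Φ(A_⊚)`
[cf. Proposition 1.4, (i)]; in particular, it follows that `B_N` is Aut-ample" (p.330 (PDF p.104)), i.e.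
([FrdI] Def. 1.2 (iv)) `Aut_C(B_N) → Aut_D(B_N^bs)` is surjective.
[cite: MochizukiEtTh2009, §5 p.330 (PDF p.104)] -/
def AutAmpleBN : Prop := Function.Surjective (𝔉.autBase 𝔉.BN)

/-- `Π^tp_Y̲ = Ker(Π^tp_X̲ ↠ l·ℤ)` is normal in `Π^tp_X̲`. [cite: MochizukiEtTh2009, Lem 5.9 (iii) p.332 (PDF p.106)] -/
theorem PiY_normal : 𝔉.PiY.Normal := MonoidHom.normal_ker 𝔉.zquot

/-- `H_{B_N} ⊆ Im(Π^tp_Y̲)` (since `Π^tp_Ÿ̲ ⊆ Π^tp_Y̲`). [cite: MochizukiEtTh2009, §5 p.331 (PDF p.105)] -/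
theorem HB_le_imPiY : 𝔉.HB ≤ 𝔉.imPiY := Subgroup.map_mono 𝔉.PiYdd_le

/-- `E_N` is the `sectionSubgroup` of `SectionTorsionSubgroup.lean` for
`(s^⊓-gp_N, Im(Π^tp_Y̲), μ_N(B_N))`.  [cite: MochizukiEtTh2009, §5 p.331 (PDF p.105)] -/
theorem EN_eq_sectionSubgroup :
    𝔉.EN = sectionSubgroup 𝔉.sgpCap 𝔉.imPiY (𝔉.muTorsion 𝔉.BN 𝔉.N) := rfl

/-! ### `E^Π_N` (Lemma 5.9 (iv), Theorem 5.10) -/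

/-- **`E^Π_N`** `:= E_N ×_{Im(Π^tp_Y̲)} Π^tp_Y̲` (Lemma 5.9 (iv), p.332 (PDF p.106); Thm. 5.10, p.333 (PDF p.107)): pairs
`(e, y)` with `e ∈ E_N`, `y ∈ Π^tp_Y̲` and `e^bs = ρ(y)` — the fibre product over `Im(Π^tp_Y̲)` formed
with the chosen representative `ρ` ("the homomorphism `Π^tp_Y ↠ Im(Π^tp_Y)` is well-defined up to
conjugation by an element of `Π^tp_X`", p.332 (PDF p.106)).  As a subgroup of `Aut_C(B_N) × Π^tp_X̲`.
[cite: MochizukiEtTh2009, Lem 5.9 (iv) p.332 (PDF p.106)] -/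
def EPiN : Subgroup (Aut 𝔉.BN × 𝔉.PiX) where
  carrier := {x | x.1 ∈ 𝔉.EN ∧ x.2 ∈ 𝔉.PiY ∧ 𝔉.autBase 𝔉.BN x.1 = 𝔉.ρ x.2}
  one_mem' := ⟨𝔉.EN.one_mem, 𝔉.PiY.one_mem, by simp⟩
  mul_mem' := by
    rintro ⟨a, x⟩ ⟨b, y⟩ ⟨ha, hx, hax⟩ ⟨hb, hy, hby⟩
    exact ⟨𝔉.EN.mul_mem ha hb, 𝔉.PiY.mul_mem hx hy, by simp [map_mul, hax, hby]⟩
  inv_mem' := by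
    rintro ⟨a, x⟩ ⟨ha, hx, hax⟩
    exact ⟨𝔉.EN.inv_mem ha, 𝔉.PiY.inv_mem hx, by simp [map_inv, hax]⟩

/-- Membership in `E^Π_N`. [cite: MochizukiEtTh2009, Lem 5.9 (iv) p.332 (PDF p.106)] -/
@[simp]
theorem mem_EPiN {x : Aut 𝔉.BN × 𝔉.PiX} :
    x ∈ 𝔉.EPiN ↔ x.1 ∈ 𝔉.EN ∧ x.2 ∈ 𝔉.PiY ∧ 𝔉.autBase 𝔉.BN x.1 = 𝔉.ρ x.2 := Iff.rfl

/-- `ϵ : E^Π_N → Aut_C(B_N)`, the homomorphism "determined by the natural projection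
`E^Π_N → E_N (⊆ Aut_C(B_N))`" (Thm. 5.10, p.333 (PDF p.107); the paper regards it as a "`μ_N`-outer
homomorphism", i.e. up to inner automorphisms by `Ker(E^Π_N ↠ Π^tp_Y) = μ_N(B_N)`; we record the
chosen representative).  [cite: MochizukiEtTh2009, Thm 5.10 p.333 (PDF p.107)] -/
def epsilon : 𝔉.EPiN →* Aut 𝔉.BN := (MonoidHom.fst _ _).comp 𝔉.EPiN.subtype

/-- The projection `E^Π_N ↠ Π^tp_Y̲` (Lemma 5.9 (iv), p.332 (PDF p.106); its kernel "`Ker(E^Π_N ↠ Π^tp_Y)`"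
is identified with `μ_N(B_N)` in Thm. 5.10 / Rmk. 5.10.3).
[cite: MochizukiEtTh2009, Lem 5.9 (iv) p.332 (PDF p.106)] -/
def toPiY : 𝔉.EPiN →* 𝔉.PiX := (MonoidHom.snd _ _).comp 𝔉.EPiN.subtype

/-- `ϵ` takes values in `E_N`. [cite: MochizukiEtTh2009, Thm 5.10 p.333 (PDF p.107)] -/
theorem epsilon_mem_EN (x : 𝔉.EPiN) : 𝔉.epsilon x ∈ 𝔉.EN := x.2.1

/-- `E^Π_N ↠ Π^tp_Y̲` takes values in `Π^tp_Y̲`. [cite: MochizukiEtTh2009, Lem 5.9 (iv) p.332 (PDF p.106)] -/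
theorem toPiY_mem_PiY (x : 𝔉.EPiN) : 𝔉.toPiY x ∈ 𝔉.PiY := x.2.2.1

/-! ### Lemma 5.8 (Conjugation by Constants), p. 331 -/

/-- "the set of elements [of `O^×(B_N)`] on which `Π^tp_Y` [i.e., `G_K`, via the natural surjection
`Π^tp_Y ↠ G_K`] acts via multiplication by an element of `μ_N(B_N)`" (proof of Lemma 5.8, p.331 (PDF p.105)),
the action being conjugation through `s^⊓-gp_N`: the predicate on `u ∈ Aut_C(B_N)`.
[cite: MochizukiEtTh2009, Lem 5.8 proof p.331 (PDF p.105)] -/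
def ActsByCyclotome (u : Aut 𝔉.BN) : Prop :=
  ∀ y ∈ 𝔉.imPiY, 𝔉.sgpCap y * u * (𝔉.sgpCap y)⁻¹ * u⁻¹ ∈ 𝔉.muTorsion 𝔉.BN 𝔉.N

/-- **[EtTh] Lemma 5.8 (Conjugation by Constants)**, main assertion (p.331 (PDF p.105)): "`(O_K^×)^{1/N}` is
equal to the set of elements of `O^×(B_N)` that normalize the subgroup `E_N ⊆ Aut_C(B_N)`."
[cite: MochizukiEtTh2009, Lem 5.8 p.331 (PDF p.105)] -/
def ConstantsEqNormalizer : Prop :=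
  𝔉.OKxRootN = 𝔉.units 𝔉.BN ⊓ Subgroup.normalizer (𝔉.EN : Set (Aut 𝔉.BN))

/-- Lemma 5.8, arithmetic step of the proof (p.331 (PDF p.105)): "this last set [the elements of `O^×(B_N)` on
which `Π^tp_Y` acts via multiplication by an element of `μ_N(B_N)`] is easily seen to coincide with
`(O_K^×)^{1/N}`" (Kummer theory over `K`; uses that "`Y̲` is geometrically connected over `K`").  Named
fact, not proved here.  [cite: MochizukiEtTh2009, Lem 5.8 proof p.331 (PDF p.105)] -/
def ConstantsActByCyclotome : Prop :=
  ∀ u : Aut 𝔉.BN, u ∈ 𝔉.OKxRootN ↔ u ∈ 𝔉.units 𝔉.BN ∧ 𝔉.ActsByCyclotome u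

/-- Lemma 5.8, "In particular, we have a natural outer action of `(O_K^×)^{1/N}/μ_N(B_N) (⥲ O_K^×)`
on `E_N`; this outer action extends to an outer action of `(K^×)^{1/N}/μ_N(B_N) (⥲ K^×) on `E_N`"
(p.331 (PDF p.105)) — the isomorphisms being the `N`-th power maps.  Typed: the `N`-th power map
`(K^×)^{1/N} → K^×` is onto, with kernel the image of `μ_N(B_N)`.
[cite: MochizukiEtTh2009, Lem 5.8 p.331 (PDF p.105)] -/
def KxRootNModCyclotome : Prop :=
  (∀ k : 𝔉.Kˣ, ∃ f ∈ 𝔉.KxRootN, f ^ (𝔉.N : ℕ) = 𝔉.constEmb k) ∧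
    ∀ f ∈ 𝔉.KxRootN, f ^ (𝔉.N : ℕ) = 1 ↔
      f ∈ ((𝔉.unitsToBirat 𝔉.BN).comp (Subgroup.inclusion (𝔉.muTorsion_le_units 𝔉.BN 𝔉.N))).range

/-- Lemma 5.8, group-theoretic step of the proof PROVED (p.331 (PDF p.105): "the set of elements of `O^×(B_N)`
that normalize the subgroup `E_N ⊆ Aut_C(B_N)` is equal to the set of elements on which `Π^tp_Y` …
acts via multiplication by an element of `μ_N(B_N)`"), modulo the section property of `s^⊓-gp_N`
and `O^×(B_N) = Ker`.  [cite: MochizukiEtTh2009, Lem 5.8 proof p.331 (PDF p.105)] -/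
theorem mem_normalizer_EN_iff (hsec : 𝔉.SgpCapSection)
    {u : Aut 𝔉.BN} (hu : u ∈ 𝔉.units 𝔉.BN) :
    u ∈ Subgroup.normalizer (𝔉.EN : Set (Aut 𝔉.BN)) ↔ 𝔉.ActsByCyclotome u := by
  haveI := 𝔉.muTorsion_normal 𝔉.BN 𝔉.N
  have hker := 𝔉.units_eq_ker 𝔉.BN
  have hs : ∀ y ∈ 𝔉.imPiY, 𝔉.autBase 𝔉.BN (𝔉.sgpCap y) = y := fun y _ => hsec y
  have hcomm : ∀ a ∈ (𝔉.autBase 𝔉.BN).ker, ∀ b ∈ (𝔉.autBase 𝔉.BN).ker, a * b = b * a := by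
    intro a ha b hb
    rw [← hker] at ha hb
    exact setLike_mul_comm (s := 𝔉.units 𝔉.BN) ha hb
  have huk : u ∈ (𝔉.autBase 𝔉.BN).ker := hker ▸ hu
  exact kernel_mem_normalizer_iff (𝔉.autBase 𝔉.BN) 𝔉.sgpCap 𝔉.imPiY (𝔉.muTorsion 𝔉.BN 𝔉.N)
    hs (𝔉.muTorsion_le_ker 𝔉.BN 𝔉.N) hcomm huk

/-- **Lemma 5.8 discharged modulo** `SgpCapSection` and the arithmetic step
`ConstantsActByCyclotome`.  [cite: MochizukiEtTh2009, Lem 5.8 p.331 (PDF p.105)] -/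
theorem constantsEqNormalizer_of (hsec : 𝔉.SgpCapSection)
    (hK : 𝔉.ConstantsActByCyclotome) : 𝔉.ConstantsEqNormalizer := by
  ext u
  rw [hK u, Subgroup.mem_inf]
  constructor
  · rintro ⟨hu, ha⟩
    exact ⟨hu, (𝔉.mem_normalizer_EN_iff hsec hu).mpr ha⟩
  · rintro ⟨hu, hn⟩
    exact ⟨hu, (𝔉.mem_normalizer_EN_iff hsec hu).mp hn⟩

/-! ### Lemma 5.9 (i)–(iii), pp. 331–332 -/

/-- **[EtTh] Lemma 5.9 (i)** (p.331 (PDF p.105)): "`s^⊓-gp_N|_{H_{B_N}}`, `s^⊔-gp_N` factor through `E_N`."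
[cite: MochizukiEtTh2009, Lem 5.9 (i) p.331 (PDF p.105)] -/
def SectionsFactor : Prop :=
  (∀ h : 𝔉.HB, 𝔉.sgpCap (h : Aut (𝔉.base.obj 𝔉.BN)) ∈ 𝔉.EN) ∧ ∀ h : 𝔉.HB, 𝔉.sgpCup h ∈ 𝔉.EN

/-- **Lemma 5.9 (i) PROVED** modulo the bi-Kummer cocycle fact (Prop. 4.3 (iii)): the first section
lands in `s^⊓-gp_N(Im Π^tp_Y̲) ⊆ E_N` since `H_{B_N} ⊆ Im(Π^tp_Y̲)`, the second differs from it by a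
`μ_N(B_N)`-valued cocycle.  [cite: MochizukiEtTh2009, Lem 5.9 (i) p.331 (PDF p.105)] -/
theorem sectionsFactor_of (hdiff : 𝔉.BiKummerDifferenceMem) : 𝔉.SectionsFactor := by
  refine ⟨fun h => ?_, fun h => ?_⟩
  · exact section_mem_sectionSubgroup 𝔉.sgpCap 𝔉.imPiY _ (𝔉.HB_le_imPiY h.2)
  · exact twisted_section_mem 𝔉.sgpCap 𝔉.imPiY (𝔉.muTorsion 𝔉.BN 𝔉.N) 𝔉.HB_le_imPiY
      𝔉.sgpCup hdiff h

/-- **[EtTh] Lemma 5.9 (ii)** (p.332 (PDF p.106)): "We have a natural exact sequence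
`1 → μ_N(B_N) → E_N → Im(Π^tp_Y) → 1`": the projection `β ↦ β^bs` maps `E_N` onto `Im(Π^tp_Y̲)` with
kernel `E_N ∩ Ker = μ_N(B_N)`.  [cite: MochizukiEtTh2009, Lem 5.9 (ii) p.332 (PDF p.106)] -/
def ENExact : Prop :=
  𝔉.EN.map (𝔉.autBase 𝔉.BN) = 𝔉.imPiY ∧ 𝔉.EN ⊓ (𝔉.autBase 𝔉.BN).ker = 𝔉.muTorsion 𝔉.BN 𝔉.N

/-- **Lemma 5.9 (ii) PROVED** modulo `SgpCapSection`.
[cite: MochizukiEtTh2009, Lem 5.9 (ii) p.332 (PDF p.106)] -/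
theorem enExact_of (hsec : 𝔉.SgpCapSection) : 𝔉.ENExact := by
  haveI := 𝔉.muTorsion_normal 𝔉.BN 𝔉.N
  have hs : ∀ y ∈ 𝔉.imPiY, 𝔉.autBase 𝔉.BN (𝔉.sgpCap y) = y := fun y _ => hsec y
  exact ⟨sectionSubgroup_map_eq _ _ _ _ hs (𝔉.muTorsion_le_ker 𝔉.BN 𝔉.N),
    sectionSubgroup_inf_ker _ _ _ _ hs (𝔉.muTorsion_le_ker 𝔉.BN 𝔉.N)⟩

/-- `Π^tp_Y̲` acts on `E_N` by INNER automorphisms through `s^⊓-gp_N ∘ ρ` (its image lies in `E_N`),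
so that the conjugation action of `Π^tp_X̲` on `E_N` (next declaration) descends to
`Π^tp_X̲/Π^tp_Y̲ ≅ l·ℤ → Out(E_N)` (Lemma 5.9 (iii)).  [cite: MochizukiEtTh2009, Lem 5.9 (iii) p.332 (PDF p.106)] -/
theorem sgpCap_rho_mem_EN {y : 𝔉.PiX} (hy : y ∈ 𝔉.PiY) : 𝔉.sgpCap (𝔉.ρ y) ∈ 𝔉.EN :=
  section_mem_sectionSubgroup _ _ _ ⟨y, hy, rfl⟩

/-- **[EtTh] Lemma 5.9 (iii)** (p.332 (PDF p.106)): "We have a natural outer action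
`l·ℤ ⥲ Π^tp_X/Π^tp_Y → Out(E_N)` determined by conjugating via the composite of the natural outer
homomorphism `Π^tp_X ↠ Aut_D(B_N^bs)` with `s^⊓-gp_N : Aut_D(B_N^bs) → Aut_C(B_N)`."  Typed as its
content: every element of `Π^tp_X̲`, through `s^⊓-gp_N ∘ ρ`, normalises `E_N` (the action then factors
through `Π^tp_X̲/Π^tp_Y̲` by `sgpCap_rho_mem_EN`).  [cite: MochizukiEtTh2009, Lem 5.9 (iii) p.332 (PDF p.106)] -/
def OuterActionLZ : Prop :=
  (⊤ : Subgroup 𝔉.PiX).map (𝔉.sgpCap.comp 𝔉.ρ) ≤ Subgroup.normalizer (𝔉.EN : Set (Aut 𝔉.BN))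

/-- `ρ(Π^tp_X̲)` normalises `Im(Π^tp_Y̲) = ρ(Π^tp_Y̲)` (`Π^tp_Y̲` is normal in `Π^tp_X̲`).
[cite: MochizukiEtTh2009, Lem 5.9 (iii) p.332 (PDF p.106)] -/
theorem rho_mem_normalizer_imPiY (g : 𝔉.PiX) :
    𝔉.ρ g ∈ Subgroup.normalizer (𝔉.imPiY : Set (Aut (𝔉.base.obj 𝔉.BN))) := by
  rw [Subgroup.mem_normalizer_iff]
  intro h
  constructor
  · rintro ⟨y, hy, rfl⟩
    exact ⟨g * y * g⁻¹, 𝔉.PiY_normal.conj_mem y hy g, by simp [map_mul, map_inv]⟩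
  · rintro ⟨y, hy, hyeq⟩
    refine ⟨g⁻¹ * y * g, ?_, ?_⟩
    · simpa using 𝔉.PiY_normal.conj_mem y hy g⁻¹
    · simp only [map_mul, map_inv, hyeq]
      group

/-- **Lemma 5.9 (iii) PROVED** (normality of `μ_N(B_N)` comes from `O^×(B_N) = Ker`, proved).
[cite: MochizukiEtTh2009, Lem 5.9 (iii) p.332 (PDF p.106)] -/
theorem outerActionLZ_of : 𝔉.OuterActionLZ := by
  haveI := 𝔉.muTorsion_normal 𝔉.BN 𝔉.N
  rintro _ ⟨g, -, rfl⟩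
  have := section_normalizer_le 𝔉.sgpCap 𝔉.imPiY (𝔉.muTorsion 𝔉.BN 𝔉.N)
    ⟨𝔉.ρ g, 𝔉.rho_mem_normalizer_imPiY g, rfl⟩
  simpa [EN_eq_sectionSubgroup] using this

/-- `s^⊔-gp_N` is a section over `H_{B_N}`: `(s^⊔-gp_N(h))^bs = h` — it differs from `s^⊓-gp_N` by a
`μ_N(B_N)`-valued cocycle.  [cite: MochizukiEtTh2009, §5 p.331 (PDF p.105)] -/
def SgpCupSection : Prop := ∀ h : 𝔉.HB, 𝔉.autBase 𝔉.BN (𝔉.sgpCup h) = h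

/-- `SgpCupSection` PROVED from the section property of `s^⊓-gp_N` and the bi-Kummer cocycle fact.
[cite: MochizukiEtTh2009, §5 p.331 (PDF p.105)] -/
theorem sgpCupSection_of (hsec : 𝔉.SgpCapSection) (hdiff : 𝔉.BiKummerDifferenceMem) :
    𝔉.SgpCupSection := by
  intro h
  have hk := 𝔉.muTorsion_le_ker 𝔉.BN 𝔉.N (hdiff h)
  rw [MonoidHom.mem_ker, map_mul, map_inv, hsec, mul_inv_eq_one] at hk
  exact hk

/-! ### Theorem 5.10 (i), (ii), pp. 333–335 -/

/-- **[EtTh] Theorem 5.10 (i)** (p.333 (PDF p.107)): "The self-equivalence `Ψ : C ⥲ C` preserves the isomorphism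
classes of `A_N`, `B_N`."  [cite: MochizukiEtTh2009, Thm 5.10 (i) p.333 (PDF p.107)] -/
def PreservesIsoClasses (Ψ : C ≌ C) : Prop :=
  Nonempty (Ψ.functor.obj 𝔉.AN ≅ 𝔉.AN) ∧ Nonempty (Ψ.functor.obj 𝔉.BN ≅ 𝔉.BN)

/-- `Ψ^Aut : Aut_C(B_N) ⥲ Aut_C(B_N)`, "the automorphism determined by applying `Ψ` followed by
conjugation by `β`" for an isomorphism `β : Ψ(B_N) ⥲ B_N` (Thm. 5.10 (ii), p.333 (PDF p.107)).
[cite: MochizukiEtTh2009, Thm 5.10 (ii) p.333 (PDF p.107)] -/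
noncomputable def psiAut (Ψ : C ≌ C) (β : Ψ.functor.obj 𝔉.BN ≅ 𝔉.BN) : Aut 𝔉.BN →* Aut 𝔉.BN :=
  β.conjAut.toMonoidHom.comp (Ψ.functor.mapAut 𝔉.BN)

/-- **[EtTh] Theorem 5.10 (ii)** (pp.333–334 (PDF pp.107–108)), for `β : Ψ(B_N) ⥲ B_N` and the induced `Ψ^Aut`
(and, as PARAMETER `ΨbiratAut`, the automorphism of `O^×(B_N^birat)` induced by
"`Ψ^birat_Aut : Aut_{C^birat}(B_N^birat) ⥲ Aut_{C^birat}(B_N^birat)`"): "`Ψ^Aut`, `Ψ^birat_Aut` preserve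
`O^×(B_N)`; `(O_K^×)^{1/N} ⊆ O^×(B_N)`; `O^×(B_N^birat)`; `(K^×)^{1/N} ⊆ O^×(B_N^birat)` and map the
data `E_N (⊆ Aut_C(B_N))`; `Im(s^⊓-gp_N)`; `Im(s^⊔-gp_N)` … to data `δ₁ · E_N · δ₁⁻¹`;
`δ₁ · Im(s^⊓-gp_N) · δ₁⁻¹`; `δ₁ · δ₂ · δ₃ · Im(s^⊔-gp_N) · δ₃⁻¹ · δ₂⁻¹ · δ₁⁻¹` for some `δ₁ ∈ O^×(B_N)`,
some `δ₂ ∈ μ_{2l·N}(B_N) ∩ (O_K^×)^{1/N} (⊆ O^×(B_N))`, and some `δ₃ ∈ s^⊓-gp_N(Aut_D(B_N^bs))`."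
[cite: MochizukiEtTh2009, Thm 5.10 (ii) p.333–334 (PDF pp.107–108)] -/
def PsiAutPreserves (Ψ : C ≌ C) (β : Ψ.functor.obj 𝔉.BN ≅ 𝔉.BN)
    (ΨbiratAut : 𝔉.biratUnits 𝔉.BN ≃* 𝔉.biratUnits 𝔉.BN) : Prop :=
  (𝔉.units 𝔉.BN).map (𝔉.psiAut Ψ β) = 𝔉.units 𝔉.BN ∧
  𝔉.OKxRootN.map (𝔉.psiAut Ψ β) = 𝔉.OKxRootN ∧
  (∀ u : 𝔉.units 𝔉.BN, ∀ hu : 𝔉.psiAut Ψ β u ∈ 𝔉.units 𝔉.BN,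
    ΨbiratAut (𝔉.unitsToBirat 𝔉.BN u) = 𝔉.unitsToBirat 𝔉.BN ⟨_, hu⟩) ∧
  𝔉.KxRootN.map ΨbiratAut.toMonoidHom = 𝔉.KxRootN ∧
  ∃ (δ₁ δ₂ δ₃ : Aut 𝔉.BN), δ₁ ∈ 𝔉.units 𝔉.BN ∧
    δ₂ ∈ 𝔉.muTorsion 𝔉.BN (2 * 𝔉.l * 𝔉.N) ⊓ 𝔉.OKxRootN ∧ δ₃ ∈ 𝔉.sgpCap.range ∧
    𝔉.EN.map (𝔉.psiAut Ψ β) = MulAut.conj δ₁ • 𝔉.EN ∧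
    (𝔉.sgpCap.range).map (𝔉.psiAut Ψ β) = MulAut.conj δ₁ • 𝔉.sgpCap.range ∧
    (𝔉.sgpCup.range).map (𝔉.psiAut Ψ β) = MulAut.conj (δ₁ * δ₂ * δ₃) • 𝔉.sgpCup.range

/-! ### The named hypotheses of §5 bundled, with their derived consequences -/

/-- The printed facts about the §5 data that the discharges in this directory take as hypotheses,
bundled for consumers (e.g. [IUTchII] §1): the defining relations and uniqueness source of
`s^⊓-gp_N, s^⊔-gp_N` (p.331 (PDF p.105)), the section property of `s^trv_N` ([FrdI] Prop. 5.6), the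
bi-Kummer cocycle (Prop. 4.3 (iii)), `O^×(B_N) = Ker` and Aut-ampleness of `B_N` (p.330 (PDF p.104)),
the arithmetic step of Lemma 5.8, and total epimorphicity at `s^⊓_N, s^⊔_N` ([FrdI] Def. 1.3).
[cite: MochizukiEtTh2009, §5 pp.330–331 (PDF pp.104–105)] -/
structure Facts : Prop where
  /-- p.331 (PDF p.105): defining relation of `s^⊓-gp_N` -/
  sgpCapSpec : 𝔉.SgpCapSpec
  /-- p.331 (PDF p.105): defining relation of `s^⊔-gp_N` -/
  sgpCupSpec : 𝔉.SgpCupSpec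
  /-- [FrdI] Prop. 5.6: `s^trv_N` is a section -/
  strvSection : 𝔉.StrvSection
  /-- Prop. 4.3 (iii): the difference cocycle is `μ_N(B_N)`-valued -/
  biKummerDifferenceMem : 𝔉.BiKummerDifferenceMem
  /-- p.330 (PDF p.104): `B_N` is Aut-ample -/
  autAmpleBN : 𝔉.AutAmpleBN
  /-- Lemma 5.8, arithmetic step -/
  constantsActByCyclotome : 𝔉.ConstantsActByCyclotome
  /-- [FrdI] Def. 1.3: `s^⊓_N` is an epimorphism -/
  epi_sCap : Epi 𝔉.sCap
  /-- [FrdI] Def. 1.3: `s^⊔_N` is an epimorphism -/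
  epi_sCup : Epi 𝔉.sCup

namespace Facts

variable {𝔉} (H : 𝔉.Facts)
include H

/-- `(s^⊓-gp_N(g))^bs = g`. [cite: MochizukiEtTh2009, §5 p.331 (PDF p.105)] -/
theorem sgpCapSection : 𝔉.SgpCapSection := 𝔉.sgpCapSection_of H.sgpCapSpec H.strvSection

/-- `(s^⊔-gp_N(h))^bs = h`. [cite: MochizukiEtTh2009, §5 p.331 (PDF p.105)] -/
theorem sgpCupSection : 𝔉.SgpCupSection := 𝔉.sgpCupSection_of H.sgpCapSection H.biKummerDifferenceMem

/-- uniqueness of `(s^⊓-gp_N, s^⊔-gp_N)`. [cite: MochizukiEtTh2009, §5 p.331 (PDF p.105)] -/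
theorem sgpUnique : 𝔉.SgpUnique :=
  haveI := H.epi_sCap; haveI := H.epi_sCup; 𝔉.sgpUnique_of H.sgpCapSpec H.sgpCupSpec

/-- Lemma 5.8. [cite: MochizukiEtTh2009, Lem 5.8 p.331 (PDF p.105)] -/
theorem constantsEqNormalizer : 𝔉.ConstantsEqNormalizer :=
  𝔉.constantsEqNormalizer_of H.sgpCapSection H.constantsActByCyclotome

/-- Lemma 5.9 (i). [cite: MochizukiEtTh2009, Lem 5.9 (i) p.331 (PDF p.105)] -/
theorem sectionsFactor : 𝔉.SectionsFactor := 𝔉.sectionsFactor_of H.biKummerDifferenceMem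

/-- Lemma 5.9 (ii). [cite: MochizukiEtTh2009, Lem 5.9 (ii) p.332 (PDF p.106)] -/
theorem enExact : 𝔉.ENExact := 𝔉.enExact_of H.sgpCapSection

end Facts

end ThetaFrobenioid

end Literature.AnabelianGeometry.EtaleTheta
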